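import Summits.Ventures.PercRepro.C041TriDomTwoPayerSplit

/-!
# ROW C-041 — THE CLASS-DESCRIBABLE PAYERS: the correction depends only on the classes of the two completions of
the split edge (p6, gen 49; P6-TWOEXIT-LEAN.md §53 ADDENDUM 23)

For a colouring `ω′` of the deletion host with four-mark pattern `(s, t)` of `(x, y, z, q)`, the two completions of
the split edge `f = xq` have the three-mark classes `cR = (xjoin3 s, proj3 t)` (`f` red) and `cB = (proj3 s, xjoin3 t)`
(`f` blue).  THE CLASS CORRECTION `corrC` is the indicator of six pairs of classes
`(cR, cB) ∈ {((s₃,⊥),(s₃,s₁)), ((⊤,⊥),(s₃,s₁)), ((⊤,⊥),(s₁,⊥)), ((⊤,⊥),(s₁,s₂)), ((⊤,s₂),(s₁,s₂)), ((⊤,s₁),(s₃,s₁))}`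
— the blue completion in the crossed class `(s₁,s₂)` or `(s₃,s₁)` is FORGIVEN (charged to the red side) when the red
completion is `(⊤,⊥)`, or `(⊤,s₂)` resp. `(⊤,s₁)`, `(s₃,⊥)`; and the `(⊤,⊥)`-credit of the red completion is moved to
the blue side when the blue completion is the neutral `(s₁,⊥)`.  It is the unique correction that is a function of the
two classes (LP over the four-point sample cone, two objectives, gen 49) and has ten refined types against the twelve of
`corrE` of `C041TriDomPayersE` (the types `(xz|yq ; x|yz|q)` and `(x|yzq ; xy|zq)` drop out).  The payers
`payerAC = CycF (xjoin3 s) (proj3 t) − corrC` and `payerBC = CycF (proj3 s) (xjoin3 t) + corrC` satisfy the keys of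
THEOREM (TWO-PAYER SPLIT) by construction (`cycDominationS_of_payersC`);
census: 0 violations on 20,000 targeted random samples and the exhaustive n = 4 / n = 5 censuses (66,636 + 437,024
checks).  Their x-splits are certified on the five-point sample cone by statements that are themselves functions of the
four completions' classes (gen 49), which the twelve-type `payerA` is not — the class form is the one to pursue.
-/

namespace PercRepro

namespace ZoneZ

namespace MultiExit

open ZoneData Finset

variable {V₁ E₁ U₁ U₂ : Type} (Z₁ : ZoneData V₁ E₁ U₁ U₂) (u u' a₁ : V₁)

/-- The six pairs of three-mark classes `(class of f red, class of f blue)` of the correction. -/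
def corrPairs : List ((P3 × P3) × (P3 × P3)) :=
  [(((false, false, true), (false, false, false)), ((false, false, true), (true, false, false))),
   (((true, true, true), (false, false, false)), ((false, false, true), (true, false, false))),
   (((true, true, true), (false, false, false)), ((true, false, false), (false, false, false))),
   (((true, true, true), (false, false, false)), ((true, false, false), (false, true, false))),
   (((true, true, true), (false, true, false)), ((true, false, false), (false, true, false))),
   (((true, true, true), (true, false, false)), ((false, false, true), (true, false, false)))]

/-- The class correction: `1` when the classes of the two completions form one of the six pairs. -/
def corrC (s t : P6) : ℤ :=
  if ((xjoin3 s, proj3 t), (proj3 s, xjoin3 t)) ∈ corrPairs then 1 else 0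

/-- The first class payer: the red-only cyclic count minus the class correction. -/
def payerAC (s t : P6) : ℤ := CycF (xjoin3 s) (proj3 t) - corrC s t

/-- The second class payer: the blue-only cyclic count plus the class correction. -/
def payerBC (s t : P6) : ℤ := CycF (proj3 s) (xjoin3 t) + corrC s t

/-- The class correction is non-negative. -/
theorem corrC_nonneg (s t : P6) : 0 ≤ corrC s t := by
  unfold corrC; split_ifs <;> decide

/-- The first class payer satisfies the key inequality (P). -/
theorem payerAC_keyP : PayerKeyP payerAC := by
  intro s _ t _
  have := corrC_nonneg s t
  unfold payerAC
  omega

/-- The class payers satisfy the key inequality (VB). -/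
theorem payersC_keyVB : PayerKeyVB payerAC payerBC := by
  intro s _ t _
  unfold payerAC payerBC
  omega

/-- The class correction vanishes when the fourth mark coincides with the anchor in both colours (on the partitions). -/
theorem corrC_eq_zero_of_xq : ∀ s ∈ valid6, ∀ t ∈ valid6, s.2.2.1 = true → t.2.2.1 = true → corrC s t = 0 := by
  decide

/-- With the fourth mark coincident with the anchor, the first class payer is the cyclic functional. -/
theorem payerAC_of_xq : ∀ s ∈ valid6, ∀ t ∈ valid6, s.2.2.1 = true → t.2.2.1 = true →
    payerAC s t = CycF (proj3 s) (proj3 t) := by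
  decide

variable [DecidableEq E₁] [Fintype E₁]

open Classical in
/-- **CONJECTURE (STOCHASTIC DOMINATION) FROM THE CLASS PAYERS**: if `payerAC` and `payerBC` have non-negative count
on every up-set of every status for every fourth mark, the cyclic orientation holds on every status. -/
theorem cycDominationS_of_payersC
    (hA : ∀ (q : V₁) (st : E₁ → EStat) (V : (E₁ → Bool) → Prop), UpSet V → 0 ≤ cntF6 Z₁ u u' q a₁ payerAC st V)
    (hB : ∀ (q : V₁) (st : E₁ → EStat) (V : (E₁ → Bool) → Prop), UpSet V → 0 ≤ cntF6 Z₁ u u' q a₁ payerBC st V)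
    (st : E₁ → EStat) : CycDominationS Z₁ a₁ u u' st :=
  cycDominationS_of_payers Z₁ u u' a₁ payerAC_keyP payersC_keyVB hA hB st

open Classical in
/-- The all-free form. -/
theorem cycDomination_of_payersC
    (hA : ∀ (q : V₁) (st : E₁ → EStat) (V : (E₁ → Bool) → Prop), UpSet V → 0 ≤ cntF6 Z₁ u u' q a₁ payerAC st V)
    (hB : ∀ (q : V₁) (st : E₁ → EStat) (V : (E₁ → Bool) → Prop), UpSet V → 0 ≤ cntF6 Z₁ u u' q a₁ payerBC st V) :
    CycDomination Z₁ a₁ u u' :=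
  cycDomination_of_payers Z₁ u u' a₁ payerAC_keyP payersC_keyVB hA hB

end MultiExit

end ZoneZ

end PercRepro
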